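import Mathlib.Algebra.Group.Nat.Even
import Mathlib.Order.Interval.Finset.Nat
import HarnessLib

/-!
# Reflection-closed index sets

Topic `Literature/GroupTheory/CombinatorialGroupTheory`.  Elementary arithmetic of subsets of
`{0, …, n - 1}` closed under the reflection `q ↦ n - 1 - q`, isolated from the case analysis of
double points on the closed path of a minimal binary product in Zieschang's proof of the homotopic
shortening theorem (Zieschang–Vogt–Coldewey, LNM 835, proof of Thm. 5.3.2), case "both cuts are
portals through the two occurrences `k`, `k̄` of ONE symbol" (value word of length `n`, cuts
between the slots `p | p + 1` of `k` and `p' | p' + 1` of `k̄`).  There a slot `q < n` of `k` is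
*crossing* iff `q ≤ p ↔ n - 1 - p' ≤ q`; the set of crossing slots (`crossSet n p p'`) is closed
under the formal-partner reflection `q ↦ n - 1 - q` and avoids its fixed point, and this pins it
down completely (`crossSet_structure`): `p = p'`, `n` is even, and the set is the interval
`[n - 1 - p, p]` (case I, `n ≤ 2 p + 1`) or `[p + 1, n - 2 - p]` (case II, `2 p + 3 ≤ n`).
The *partition lemmas* `add_eq_of_interval_split` (head form), `add_eq_of_interval_split'`,
`add_eq_of_interval_split_sub` (tail forms) then turn a splitting of such an interval into a
prefix-type and a suffix-type part into the identity `c + d = n` for the two cancellation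
lengths, whence both are exactly `n / 2` (`two_mul_eq_of_add_eq`, `crossSet_caseI_halves`,
`crossSet_caseII_halves`); the last section treats an interval `[a, b]` closed under the
reflection (`a + b + 1 = n`, `add_eq_of_interval_reflection_closed`) and covered by a prefix
`[0, c)` and a suffix `[n - d, n)` of half-lengths (`two_mul_eq_of_symmetric_interval_covered`),
the shape of the case "both cuts inside one kernel".

Everything here is routine (`omega` after two or three instantiations); no named facts.  The
combinatorial meaning of the hypotheses lives in the files on Zieschang's proof
(`Literature/Topology/FourManifolds/SurfaceGroupNielsenCore*.lean`), not here.

## References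

* H. Zieschang, E. Vogt, H.-D. Coldewey, *Surfaces and Planar Discontinuous Groups*, LNM 835
  (1980), proof of Thm. 5.3.2. [ZieschangVogtColdewey1980]
-/

namespace Literature.GroupTheory.CombinatorialGroupTheory

/-! ### The crossing set of the same-symbol double-portal case -/

/-- The **crossing set** `{q < n | q ≤ p ↔ n - 1 - p' ≤ q}` of the same-symbol double-portal
case: the slots `q` of the occurrence `k` (cut at `p | p + 1`) lying on the other side than their
formal partner `n - 1 - q` in `k̄` (cut at `p' | p' + 1`). [folklore] -/
def crossSet (n p p' : ℕ) : Finset ℕ :=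
  (Finset.range n).filter (fun q => (q ≤ p ↔ n - 1 - p' ≤ q))

/-- Membership in the crossing set. [folklore] -/
@[simp] theorem mem_crossSet {n p p' q : ℕ} :
    q ∈ crossSet n p p' ↔ q < n ∧ (q ≤ p ↔ n - 1 - p' ≤ q) := by
  simp [crossSet]

/-- The borderline ("mirrored") case `p + p' = n - 2`: the crossing set is empty. [folklore] -/
theorem crossSet_eq_empty {n p p' : ℕ} (h : p + p' + 2 = n) : crossSet n p p' = ∅ := by
  ext q
  simp only [mem_crossSet, Finset.notMem_empty, iff_false, not_and]
  intro hq
  omega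

/-- The overlapping case `p + p' ≥ n - 1`: the crossing set is `[n - 1 - p', p]`. [folklore] -/
theorem crossSet_eq_Ico_of_le {n p p' : ℕ} (hp : p < n) (h : n ≤ p + p' + 1) :
    crossSet n p p' = Finset.Ico (n - 1 - p') (p + 1) := by
  ext q
  simp only [mem_crossSet, Finset.mem_Ico]
  omega

/-- The gap case `p + p' ≤ n - 3`: the crossing set is `[p + 1, n - 2 - p']`. [folklore] -/
theorem crossSet_eq_Ico_of_ge {n p p' : ℕ} (h : p + p' + 3 ≤ n) :
    crossSet n p p' = Finset.Ico (p + 1) (n - 1 - p') := by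
  ext q
  simp only [mem_crossSet, Finset.mem_Ico]
  omega

/-- **Structure of a reflection-closed, fixed-point-free, non-empty crossing set.**  If the
crossing set of the same-symbol double-portal case (`p + 1 < n`, `p' + 1 < n`) is closed under
the reflection `q ↦ n - 1 - q`, contains no fixed point of it (`2 q + 1 ≠ n`) and is non-empty,
then `p = p'`, `n` is even, and either `n ≤ 2 p + 1` (so `p ≥ n / 2`) and the set is the interval
`[n - 1 - p, p]` (case I), or `2 p + 3 ≤ n` (so `p ≤ n / 2 - 2`) and the set is the interval
`[p + 1, n - 2 - p]` (case II).  (The borderline `p + p' = n - 2` is excluded by non-emptiness.)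
[folklore] -/
theorem crossSet_structure {n p p' : ℕ} (hp : p + 1 < n) (hp' : p' + 1 < n)
    (hclosed : ∀ q ∈ crossSet n p p', n - 1 - q ∈ crossSet n p p')
    (hnofix : ∀ q ∈ crossSet n p p', 2 * q + 1 ≠ n) (hne : (crossSet n p p').Nonempty) :
    p = p' ∧ Even n ∧
      ((n ≤ 2 * p + 1 ∧ crossSet n p p' = Finset.Ico (n - 1 - p) (p + 1)) ∨
        (2 * p + 3 ≤ n ∧ crossSet n p p' = Finset.Ico (p + 1) (n - 1 - p))) := by
  rcases lt_trichotomy n (p + p' + 2) with hlt | heq | hgt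
  · -- case I: the set is `[n - 1 - p', p]`; closure at the two ends forces `p = p'`
    have hS := crossSet_eq_Ico_of_le (p' := p') (by omega : p < n) (by omega)
    have h1 := hclosed p (by rw [hS, Finset.mem_Ico]; omega)
    have h2 := hclosed (n - 1 - p') (by rw [hS, Finset.mem_Ico]; omega)
    rw [hS, Finset.mem_Ico] at h1 h2
    obtain rfl : p = p' := by omega
    refine ⟨rfl, ?_, Or.inl ⟨by omega, hS⟩⟩
    rw [Nat.even_iff]
    by_contra hodd
    exact hnofix (n / 2) (by rw [hS, Finset.mem_Ico]; omega) (by omega)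
  · exact absurd hne (by rw [crossSet_eq_empty heq.symm]; exact Finset.not_nonempty_empty)
  · -- case II: the set is `[p + 1, n - 2 - p']`; closure at the two ends forces `p = p'`
    have hS := crossSet_eq_Ico_of_ge (n := n) (p := p) (p' := p') (by omega)
    have h1 := hclosed (p + 1) (by rw [hS, Finset.mem_Ico]; omega)
    have h2 := hclosed (n - 2 - p') (by rw [hS, Finset.mem_Ico]; omega)
    rw [hS, Finset.mem_Ico] at h1 h2
    obtain rfl : p = p' := by omega
    refine ⟨rfl, ?_, Or.inr ⟨by omega, hS⟩⟩
    rw [Nat.even_iff]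
    by_contra hodd
    exact hnofix (n / 2) (by rw [hS, Finset.mem_Ico]; omega) (by omega)

/-! ### Partition lemmas -/

/-- **Prefix/suffix partition of an interval, head form.**  If on the interval `[L, R]` the
predicates "`q < c`" (a prefix) and "`n - 1 - q < d`" (a suffix) are complementary, the left end
is of the first kind (`L < c`) and the first kind does not exhaust the interval (`c ≤ R`), then
`c + d = n`: the prefix is `[L, c - 1]`, the suffix is `[n - d, R]`, and they fit together
exactly at `c = n - d`. [folklore] -/
theorem add_eq_of_interval_split {L R c d n : ℕ}
    (hsplit : ∀ q, L ≤ q → q ≤ R → (q < c ↔ ¬ (n - 1 - q < d))) (h1 : L < c) (h2 : c ≤ R) :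
    c + d = n := by
  have hc := hsplit c (by omega) h2
  have hc' := hsplit (c - 1) (by omega) (by omega)
  omega

/-- Head form, with the two ends of the interval of the two kinds: `L < c` and
`n - 1 - R < d`. [folklore] -/
theorem add_eq_of_interval_split_ends {L R c d n : ℕ} (hLR : L ≤ R)
    (hsplit : ∀ q, L ≤ q → q ≤ R → (q < c ↔ ¬ (n - 1 - q < d))) (hL : L < c)
    (hR : n - 1 - R < d) : c + d = n := by
  have h := hsplit R hLR le_rfl
  exact add_eq_of_interval_split hsplit hL (by omega)

/-- **Prefix/suffix partition of an interval, tail form.**  If on the interval `[L, R]` the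
predicates "`n ≤ q + c`" (a suffix, the slot `q` lies in the last `c` of `n` positions) and
"`n ≤ (n - 1 - q) + d`" (a prefix, the reflected slot lies in the last `d` positions) are
complementary, the left end is not of the first kind (`L + c < n`) and the right end is of the
first kind (`n ≤ R + c`), then `c + d = n`. [folklore] -/
theorem add_eq_of_interval_split' {L R c d n : ℕ}
    (hsplit : ∀ q, L ≤ q → q ≤ R → (n ≤ q + c ↔ ¬ (n ≤ n - 1 - q + d))) (h1 : L + c < n)
    (h2 : n ≤ R + c) : c + d = n := by
  have hc := hsplit (n - c) (by omega) (by omega)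
  have hc' := hsplit (n - c - 1) (by omega) (by omega)
  omega

/-- Tail form, with the two ends of the interval of the two kinds: `n ≤ (n - 1 - L) + d` and
`n ≤ R + c`. [folklore] -/
theorem add_eq_of_interval_split_ends' {L R c d n : ℕ} (hLR : L ≤ R)
    (hsplit : ∀ q, L ≤ q → q ≤ R → (n ≤ q + c ↔ ¬ (n ≤ n - 1 - q + d)))
    (hL : n ≤ n - 1 - L + d) (hR : n ≤ R + c) : c + d = n := by
  have h := hsplit L le_rfl hLR
  exact add_eq_of_interval_split' hsplit (by omega) hR

/-- Tail form, normalised predicates: "`n - c ≤ q`" (a suffix) and "`q < d`" (a prefix) are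
complementary on `[L, R]`, `L < n - c` and `n - c ≤ R`; then `c + d = n`. [folklore] -/
theorem add_eq_of_interval_split_sub {L R c d n : ℕ}
    (hsplit : ∀ q, L ≤ q → q ≤ R → (n - c ≤ q ↔ ¬ (q < d))) (h1 : L < n - c)
    (h2 : n - c ≤ R) : c + d = n := by
  have hc := hsplit (n - c) (by omega) h2
  have hc' := hsplit (n - c - 1) (by omega) (by omega)
  omega

/-! ### Half-cancellations -/

/-- Two quantities at most `n / 2` adding up to `n` are both exactly `n / 2`. [folklore] -/
theorem two_mul_eq_of_add_eq {c d n : ℕ} (hc : 2 * c ≤ n) (hd : 2 * d ≤ n) (h : c + d = n) :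
    2 * c = n ∧ 2 * d = n := by
  omega

/-- **Case I forces two first-half cancellations.**  If on the case-I interval `[n - 1 - p, p]`
(`n ≤ 2 p + 1`) the head-type predicates `q < c` and `n - 1 - q < d` are complementary, with
`c, d ≤ n / 2`, then `2 c = n` and `2 d = n`. [folklore] -/
theorem crossSet_caseI_halves {n p c d : ℕ} (hpn : n ≤ 2 * p + 1)
    (hsplit : ∀ q ∈ Finset.Ico (n - 1 - p) (p + 1), (q < c ↔ ¬ (n - 1 - q < d)))
    (hc : 2 * c ≤ n) (hd : 2 * d ≤ n) : 2 * c = n ∧ 2 * d = n := by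
  have hs : ∀ q, n - 1 - p ≤ q → q ≤ p → (q < c ↔ ¬ (n - 1 - q < d)) :=
    fun q h₁ h₂ => hsplit q (by rw [Finset.mem_Ico]; omega)
  have hL := hs (n - 1 - p) le_rfl (by omega)
  have hR := hs p (by omega) le_rfl
  exact two_mul_eq_of_add_eq hc hd (add_eq_of_interval_split hs (by omega) (by omega))

/-- **Case II forces two second-half cancellations.**  If on the case-II interval
`[p + 1, n - 2 - p]` (`2 p + 3 ≤ n`) the tail-type predicates `n ≤ q + c` and
`n ≤ (n - 1 - q) + d` are complementary, with `c, d ≤ n / 2`, then `2 c = n` and `2 d = n`.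
[folklore] -/
theorem crossSet_caseII_halves {n p c d : ℕ} (hpn : 2 * p + 3 ≤ n)
    (hsplit : ∀ q ∈ Finset.Ico (p + 1) (n - 1 - p), (n ≤ q + c ↔ ¬ (n ≤ n - 1 - q + d)))
    (hc : 2 * c ≤ n) (hd : 2 * d ≤ n) : 2 * c = n ∧ 2 * d = n := by
  have hs : ∀ q, p + 1 ≤ q → q ≤ n - 2 - p → (n ≤ q + c ↔ ¬ (n ≤ n - 1 - q + d)) :=
    fun q h₁ h₂ => hsplit q (by rw [Finset.mem_Ico]; omega)
  have hL := hs (p + 1) le_rfl (by omega)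
  have hR := hs (n - 2 - p) (by omega) le_rfl
  exact two_mul_eq_of_add_eq hc hd (add_eq_of_interval_split' hs (by omega) (by omega))

/-! ### Symmetric intervals covered by two half-length ends -/

/-- An interval `[a, b]` (`a ≤ b < n`) closed under the reflection `q ↦ n - 1 - q` is symmetric
about `(n - 1) / 2`: `a + b + 1 = n`. [folklore] -/
theorem add_eq_of_interval_reflection_closed {n a b : ℕ} (hab : a ≤ b) (hbn : b < n)
    (hclosed : ∀ q, a ≤ q → q ≤ b → a ≤ n - 1 - q ∧ n - 1 - q ≤ b) : a + b + 1 = n := by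
  have ha := hclosed a le_rfl hab
  have hb := hclosed b hab le_rfl
  omega

/-- **A symmetric interval inside two half-length ends.**  If the non-empty interval `[a, b]`
with `a + b + 1 = n` is covered by the prefix `[0, c)` and the suffix `[n - d, n)` with
`c, d ≤ n / 2`, then `2 c = n` and `2 d = n` (for odd `n` the hypotheses are contradictory: the
midpoint `(n - 1) / 2` is covered by neither end). [folklore] -/
theorem two_mul_eq_of_symmetric_interval_covered {n a b c d : ℕ} (hab : a ≤ b)
    (hsym : a + b + 1 = n) (hcov : ∀ q, a ≤ q → q ≤ b → q < c ∨ n - d ≤ q) (hc : 2 * c ≤ n)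
    (hd : 2 * d ≤ n) : 2 * c = n ∧ 2 * d = n := by
  have h₁ := hcov ((n - 1) / 2) (by omega) (by omega)
  have h₂ := hcov (n / 2) (by omega) (by omega)
  omega

end Literature.GroupTheory.CombinatorialGroupTheory
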